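import Literature.Algebra.EuclideanLattices.MRGapCVPWitnessLawD
import Literature.Algebra.EuclideanLattices.MRGapCVPIdealisedZ
import Literature.Probability.Distributions.IndepProductLawDistance
import HarnessLib

/-!
# MR07 Thm. 5.23, NO instances, on the dual-grid model: the conditional witness law satisfies (16)–(18) and the witnesses pass the machine-decidable verifier — proved

Topic `Algebra/EuclideanLattices` (family `pqc`). Twin of `MRGapCVPBlocks.lean` + the witness level of
`MRGapCVPIdealisedZ.lean` for the dual-grid model of `DualGridAttemptSuccess` / `MRGapCVPRunD` (the
bit-level model the machine of MR07 Thm. 5.23 runs: `Λ = dualLat B = det(B)²·L(B)*`, witnesses typed in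
`WLat B = (Λ*)*`, so that the verifier analysis of `MRGapCVPIdealisedZ` applies with `L = L₀ := Λ*`).
Micciancio–Regev 2007, proof of Thm. 5.23, NO case (authors' version pp. 29–31):

* `condLawD_zero` — with zero shifts `condLawD = ⨂ᵢ D_{Λ,s,ĉᵢ}`;
* `integral_indepLaw_cos_witness_le_of_eq`, `smoothingParameter_congr` — the tree's eq. (16) lemma and
  the smoothing parameter transported along an EQUALITY of lattices (`Λ = (Λ*)*`);
* `norm_xVecOf_sub_le` — Lemma 5.8 (iii) for the attempt from offset representatives:
  `‖x − ∑ zᵢĉᵢ‖ ≤ n√m‖z‖σ/q` when `A z ≡ 0` for the true query (`DualGridAttemptSpec.norm_xVec_sub_le`);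
* `tsum_condD_toReal_mul_cos_le`, `tsum_condD_toReal_mul_indicator_le`, `tsum_condD_mul_ofReal_inner_sq_le`,
  `tsum_condD_mul_enorm_sq_le` — **eqs. (16)–(18) for the conditional witness law `D` of `wRunD`**;
* `witnessesOf`, `tvDist_witnessesOf_le`, `witnessesD` (definitions with bodies) — `N_w` blocks of `k` runs of
  `W`, first success per block, and their stability in the run law (`≤ N_w k Δ`);
* `toReal_witnessesD_not_acceptsZ_le` — **the witnesses of a NO instance are rejected by the modified
  verifier only with small probability**: with `L₀ = Λ*`, `0 < g < λ₁(L₀)`, `dist(kt′, L₀) > g` for odd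
  `k`, ANY Gaussian parameter `s ≥ 2√n/g` with `2η_ε(Λ) ≤ s` (`ε = 2⁻ⁿ`) and `n√m βσ/q < sβ`
  (Lemma 5.8 (iii) + the modulus condition), thresholds `θ_b ≤ (1 − 2ε)/(2π²) − δ_H`, `Θ ≥ 3N_w(2sβ)²`:
  `Pr[¬acceptsZ] ≤ N_w(1 − (δ′ − m(2ε/(1+ε) + n·dT/2^ℓ + n·q/N)))^k + e^{−32N_wδ_H²} +
  e^{−N_w/(nm)²}(4√n·nm)ⁿ + N_w·m(1+ε)/(1−ε)ε`.

All proved; no named fact.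

## References

* D. Micciancio, O. Regev, *Worst-case to average-case reductions based on Gaussian measures*,
  SIAM J. Comput. 37 (2007) 267–302; authors' version, Thm. 5.23 and its proof, pp. 28–31.
-/

noncomputable section

open scoped Classical ENNReal Real InnerProductSpace

namespace Literature.Algebra.EuclideanLattices

open Module Submodule Matrix GSInverse Finset Literature.Probability.Distributions PMF MeasureTheory Metric
  Literature.Computability.Cryptography Literature.Computability.Cryptography.SIS MicciancioRegev2007
  Literature.NumberTheory.Sieve.Vinogradov

/-! ### Transport along an equality of lattices -/

section Transport

variable {V : Type*} [NormedAddCommGroup V] [InnerProductSpace ℝ V] [FiniteDimensional ℝ V]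
  [MeasurableSpace V] [BorelSpace V]

/-- **Eq. (16) for a lattice EQUAL to a dual lattice** (the tree's `integral_indepLaw_cos_witness_le`, whose
Gaussians live on `dualLattice L`, transported to any `Λ' = L*`; all instances involved are propositions).
[cite: MicciancioRegev2007, Thm. 5.23 (proof, p. 30, eq. (16))] -/
theorem MicciancioRegev2007.integral_indepLaw_cos_witness_le_of_eq {m : ℕ} (Λ' : Submodule ℤ V)
    [DiscreteTopology Λ'] [IsZLattice ℝ Λ'] (L : Submodule ℤ V) [DiscreteTopology L] [IsZLattice ℝ L]
    (hΛ : Λ' = dualLattice L) (hn : 2 ≤ finrank ℝ V) {g : ℝ} (hg : 0 < g) (hgL : g < minNorm L)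
    (c : Fin m → V) {j : Fin m} (e t : V) {z : Fin m → ℤ} (hzj : z j ≠ 0)
    (hfar : g < infDist (((-z j : ℤ) : ℝ) • t) (L : Set V)) :
    ∫ y, Real.cos (2 * π * ⟪t, e - ∑ i, (z i : ℝ) • ((y i : V) - c i)⟫_ℝ)
        ∂(indepLaw m fun i => discreteGaussian Λ' (2 * Real.sqrt (finrank ℝ V) / g) (c i)).toMeasure ≤
      2 * (2⁻¹ : ℝ) ^ finrank ℝ V := by
  subst hΛ
  exact integral_indepLaw_cos_witness_le L hn hg hgL c e t hzj hfar

omit [FiniteDimensional ℝ V] [MeasurableSpace V] [BorelSpace V] in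
/-- Equal lattices have equal smoothing parameters (the instances are propositions). [folklore] -/
theorem smoothingParameter_congr {Λ₁ Λ₂ : Submodule ℤ V} [DiscreteTopology Λ₁] [IsZLattice ℝ Λ₁]
    [DiscreteTopology Λ₂] [IsZLattice ℝ Λ₂] (h : Λ₁ = Λ₂) (ε : ℝ) :
    smoothingParameter Λ₁ ε = smoothingParameter Λ₂ ε := by
  subst h; rfl

end Transport

namespace DualGrid

variable {n : ℕ} (B : Matrix (Fin n) (Fin n) ℤ) (N : ℕ) (S : Fin n → Fin n → ℤ) [NeZero N] {m : ℕ}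

/-! ### The conditional law with zero shifts, and Lemma 5.8 (iii) from representatives -/

omit [NeZero N] in
/-- `fineGridVec 0 = 0`. [folklore] -/
theorem fineGridVec_zero : fineGridVec n N (0 : Fin n → ℤ) = 0 := by
  simp [fineGridVec]

/-- With zero shifts the conditional law is `⨂ᵢ D_{Λ,s,ĉᵢ}`. [folklore] -/
theorem condLawD_zero (s : ℝ) (c : Fin m → Grp B N) :
    condLawD B N s (fun _ => 0) c =
      indepLaw m fun i => discreteGaussian (dualLat B) s (((rep B N (c i) : fineGrid n N) : EuclideanSpace ℝ (Fin n))) := by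
  simp only [condLawD, fineGridVec_zero, zero_add]

variable {B N S} in
/-- **Lemma 5.8 (iii) for the attempt from offset representatives**: if `A z ≡ 0 (mod q)` for the true
query then `‖x − ∑ zᵢĉᵢ‖ ≤ n√m‖z‖σ/q` (`‖sⱼ‖ ≤ σ`, `ĉᵢ = rep cᵢ`).
[cite: MicciancioRegev2007, Lemma 5.8 (iii) (proof, p. 21)] -/
theorem norm_xVecOf_sub_le (hB : B.det ≠ 0) (hS : ∀ j, intVecToEuclidean n (S j) ∈ dualLat B)
    (hli : LinearIndependent ℝ fun j => intVecToEuclidean n (S j)) {q : ℕ} (hq : 0 < q)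
    (c : Fin m → Grp B N) (κ : Fin m → Fin n → ℤ) {z : Fin m → ℤ}
    (hAz : (queryMatrixD B N S q c κ).mulVec (fun i => (z i : ZMod q)) = 0)
    {σ : ℝ} (hσ : ∀ j, ‖intVecToEuclidean n (S j)‖ ≤ σ) :
    ‖intVecToEuclidean n (xVecOf B N S q (fun i => crepInt B N (c i)) κ z) -
        ∑ i, (z i : ℝ) • (((rep B N (c i) : fineGrid n N) : EuclideanSpace ℝ (Fin n)))‖ ≤
      n * Real.sqrt m * ‖intVecToEuclidean m z‖ * σ / q := by
  set Kf : Fin m → Fin n → ℤ := fun i => -liftVec B N (c i) with hKf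
  have hcrep : ∀ i, crep B N (Kf i) = crepInt B N (c i) := fun i => crep_neg_liftVec (c i)
  have hxK : xVec B N S q Kf κ z = xVecOf B N S q (fun i => crepInt B N (c i)) κ z := by
    rw [xVec_eq_xVecOf]; simp only [hcrep]
  have hdvd : ∀ j, (q : ℤ) ∣ Az B N S q Kf κ z j := fun j => by
    rw [Az_eq_AzOf]; simp only [hcrep]; exact dvd_AzOf_of_mulVec_eq_zero c κ hAz j
  have h := norm_xVec_sub_le hB hS hli hq Kf κ z hdvd hσ
  rw [hxK] at h
  simp only [hcrep] at h
  rw [show (fun i => (z i : ℝ) • (((rep B N (c i) : fineGrid n N) : EuclideanSpace ℝ (Fin n)))) =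
      fun i => (z i : ℝ) • ((N : ℝ)⁻¹ • intVecToEuclidean n (crepInt B N (c i))) from funext fun i => by rw [coe_rep_eq]]
  exact h

/-! ### Eqs. (16)–(18) for the conditional witness law `D` of `wRunD` -/

section Cond

variable [IsZLattice ℝ (dualLat B)] (hB : B.det ≠ 0) (hS : ∀ j, intVecToEuclidean n (S j) ∈ dualLat B)
  (hli : LinearIndependent ℝ fun j => intVecToEuclidean n (S j)) {q : ℕ} [NeZero q]
  (O : Matrix (Fin n) (Fin m) (ZMod q) → PMF (Fin m → ℤ))

include hS

omit [NeZero q] in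
/-- **Eq. (16) for the conditional witness law on a NO instance** (`n ≥ 2`, `L₀ = Λ*`, `0 < g < λ₁(L₀)`,
`dist(kt′, L₀) > g` for every odd `k`, Gaussian parameter `2√n/g`): `∑_w D(w) cos(2π⟨t′, w⟩) ≤ 2·2⁻ⁿ`.
[cite: MicciancioRegev2007, Thm. 5.23 (proof, p. 30, eq. (16): "this is true also without conditioning")] -/
theorem tsum_condD_toReal_mul_cos_le (hn : 2 ≤ n) {g : ℝ} (hg : 0 < g)
    (hgL : g < minNorm (dualLattice (dualLat B))) (t' : EuclideanSpace ℝ (Fin n))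
    (hodd : ∀ k : ℤ, Odd k → g < infDist ((k : ℝ) • t') ((dualLattice (dualLat B) : Set (EuclideanSpace ℝ (Fin n)))))
    (β : ℝ) (ℓ : ℕ) (hρ : (wRunD B N S hB O (2 * Real.sqrt n / g) β ℓ) none ≠ 1) {D : PMF (WLat B)}
    (hD : ∀ w, (wRunD B N S hB O (2 * Real.sqrt n / g) β ℓ) (some w) =
      (1 - (wRunD B N S hB O (2 * Real.sqrt n / g) β ℓ) none) * D w) :
    ∑' w, (D w).toReal * Real.cos (2 * π * ⟪t', ((w : WLat B) : EuclideanSpace ℝ (Fin n))⟫_ℝ) ≤ 2 * (2⁻¹ : ℝ) ^ n := by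
  have hfin : finrank ℝ (EuclideanSpace ℝ (Fin n)) = n := finrank_euclideanSpace_fin
  refine tsum_condD_toReal_mul_le B N S hB hS O _ β ℓ hρ hD (fun v => Real.cos (2 * π * ⟪t', v⟫_ℝ)) zero_le_one
    (fun v => Real.abs_cos_le_one _) (by positivity) ?_
  intro c κ z _ hsol
  obtain ⟨j, hj, hzj⟩ := exists_odd_ne_zero_of_isSolution' hsol
  have hfar : g < infDist (((-z j : ℤ) : ℝ) • t') ((dualLattice (dualLat B) : Set (EuclideanSpace ℝ (Fin n)))) :=
    hodd (-z j) hj.neg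
  set x := intVecToEuclidean n (xVecOf B N S q (fun i => crepInt B N (c i)) κ z) with hx
  set cc : Fin m → EuclideanSpace ℝ (Fin n) := fun i => (((rep B N (c i) : fineGrid n N) : EuclideanSpace ℝ (Fin n))) with hcc
  have hint := integral_indepLaw_cos_witness_le_of_eq (m := m) (dualLat B) (dualLattice (dualLat B))
    (dualLattice_dualLattice _).symm (by rw [hfin]; exact hn) hg hgL cc (x - ∑ i, (z i : ℝ) • cc i) t' hzj hfar
  rw [hfin] at hint
  rw [condLawD_zero, ← integral_toMeasure_eq_tsum_of_abs_le _ (M := 1) (fun y => Real.abs_cos_le_one _)]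
  refine le_of_eq_of_le (integral_congr_ae (Filter.Eventually.of_forall fun y => ?_)) hint
  have hout : outputD B N S q (((c, κ), (queryMatrixD B N S q c κ, z)), y) =
      x - ∑ i, (z i : ℝ) • ((y i : dualLat B) : EuclideanSpace ℝ (Fin n)) := rfl
  simp only [hout, sub_sum_smul_eq x cc (fun i => ((y i : dualLat B) : EuclideanSpace ℝ (Fin n))) z, hcc]

include hli

/-- **Eq. (17) for the conditional witness law** (`0 < ε < 1`, `0 < s`, `η_ε(Λ) ≤ s`, `nm ≥ 1`, `‖sⱼ‖ ≤ σ`,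
`n√m βσ/q < sβ` — Lemma 5.8 (iii) with the modulus condition): `Pr_D[√(nm)·2sβ ≤ ‖w‖] ≤ m(1+ε)/(1−ε)2⁻ⁿ`.
[cite: MicciancioRegev2007, Thm. 5.23 (proof, p. 31, eq. (17))] -/
theorem tsum_condD_toReal_mul_indicator_le {ε s β σ : ℝ} (hε : 0 < ε) (hε1 : ε < 1) (hs : 0 < s)
    (hηs : smoothingParameter (dualLat B) ε ≤ s) (hn : 1 ≤ n) (hm : 0 < m) (hσ : ∀ j, ‖intVecToEuclidean n (S j)‖ ≤ σ)
    (hxq : n * Real.sqrt m * β * σ / q < s * β) (ℓ : ℕ)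
    (hρ : (wRunD B N S hB O s β ℓ) none ≠ 1) {D : PMF (WLat B)}
    (hD : ∀ w, (wRunD B N S hB O s β ℓ) (some w) = (1 - (wRunD B N S hB O s β ℓ) none) * D w) :
    ∑' w, (D w).toReal *
        (if Real.sqrt (n * m) * (2 * s * β) ≤ ‖((w : WLat B) : EuclideanSpace ℝ (Fin n))‖ then (1 : ℝ) else 0) ≤
      m * ((1 + ε) / (1 - ε) * (2⁻¹ : ℝ) ^ n) := by
  have hfin : finrank ℝ (EuclideanSpace ℝ (Fin n)) = n := finrank_euclideanSpace_fin
  have hq : 0 < q := Nat.pos_of_ne_zero (NeZero.ne q)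
  refine tsum_condD_toReal_mul_le B N S hB hS O s β ℓ hρ hD
    (fun v => if Real.sqrt (n * m) * (2 * s * β) ≤ ‖v‖ then (1 : ℝ) else 0) zero_le_one
    (fun v => by split_ifs <;> simp) (by positivity) ?_
  intro c κ z _ hsol
  set x := intVecToEuclidean n (xVecOf B N S q (fun i => crepInt B N (c i)) κ z) with hx
  set cc : Fin m → EuclideanSpace ℝ (Fin n) := fun i => (((rep B N (c i) : fineGrid n N) : EuclideanSpace ℝ (Fin n))) with hcc
  have hzn : ‖intVecToEuclidean m z‖ ≤ β := hsol.2.2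
  have hz2 : ∑ i, (z i : ℝ) ^ 2 ≤ β ^ 2 := sum_sq_le_of_isSolution' hsol
  have hxC : ‖x - ∑ i, (z i : ℝ) • cc i‖ < s * β := by
    have h := norm_xVecOf_sub_le hB hS hli hq c κ hsol.2.1 hσ
    refine lt_of_le_of_lt (h.trans ?_) hxq
    have hσ0 : 0 ≤ σ := (norm_nonneg _).trans (hσ ⟨0, hn⟩)
    gcongr
  have hnm : 1 ≤ finrank ℝ (EuclideanSpace ℝ (Fin n)) * m := by
    rw [hfin]; exact Nat.one_le_iff_ne_zero.2 (Nat.mul_ne_zero (by omega) (by omega))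
  have h := toReal_indepLaw_le_norm_witness_le (dualLat B) hε hε1 hs hηs cc hxC hz2 hnm
  rw [hfin] at h
  rw [condLawD_zero]
  rw [toReal_toOuterMeasure_apply] at h
  refine le_of_eq_of_le (tsum_congr fun y => ?_) h
  have hout : outputD B N S q (((c, κ), (queryMatrixD B N S q c κ, z)), y) =
      x - ∑ i, (z i : ℝ) • ((y i : dualLat B) : EuclideanSpace ℝ (Fin n)) := rfl
  simp only [Set.indicator_apply, Set.mem_setOf_eq, hout,
    sub_sum_smul_eq x cc (fun i => ((y i : dualLat B) : EuclideanSpace ℝ (Fin n))) z]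
  split_ifs <;> simp [hcc]

/-- **Eq. (18) for the conditional witness law** (`2η_ε(Λ) ≤ s`, side condition `≤ 1`, unit `u`,
`n√m βσ/q < sβ`): `∑_w D(w) ⟨u, w⟩² ≤ (2sβ)²` (in `ℝ≥0∞`). [cite: MicciancioRegev2007, Thm. 5.23 (proof, p. 31, eq. (18))] -/
theorem tsum_condD_mul_ofReal_inner_sq_le {ε s β σ : ℝ} (hε : 0 < ε) (hε1 : ε < 1) (hs : 0 < s)
    (hηs : 2 * smoothingParameter (dualLat B) ε ≤ s) (hn : 1 ≤ n) (hm : 0 < m) (hσ : ∀ j, ‖intVecToEuclidean n (S j)‖ ≤ σ)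
    (hxq : n * Real.sqrt m * β * σ / q < s * β)
    (hnum : 1 / (2 * π) + ε / (1 - ε) + (ε / (1 - ε)) ^ 2 * m ≤ 1) (ℓ : ℕ)
    (hρ : (wRunD B N S hB O s β ℓ) none ≠ 1) {D : PMF (WLat B)}
    (hD : ∀ w, (wRunD B N S hB O s β ℓ) (some w) = (1 - (wRunD B N S hB O s β ℓ) none) * D w)
    {u : EuclideanSpace ℝ (Fin n)} (hu : ‖u‖ = 1) :
    ∑' w, D w * ENNReal.ofReal (⟪u, ((w : WLat B) : EuclideanSpace ℝ (Fin n))⟫_ℝ ^ 2) ≤ ENNReal.ofReal ((2 * s * β) ^ 2) := by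
  have hq : 0 < q := Nat.pos_of_ne_zero (NeZero.ne q)
  refine tsum_condD_mul_le B N S hB hS O s β ℓ hρ hD (fun v => ENNReal.ofReal (⟪u, v⟫_ℝ ^ 2)) ?_
  intro c κ z _ hsol
  set x := intVecToEuclidean n (xVecOf B N S q (fun i => crepInt B N (c i)) κ z) with hx
  set cc : Fin m → EuclideanSpace ℝ (Fin n) := fun i => (((rep B N (c i) : fineGrid n N) : EuclideanSpace ℝ (Fin n))) with hcc
  have hz2 : ∑ i, (z i : ℝ) ^ 2 ≤ β ^ 2 := sum_sq_le_of_isSolution' hsol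
  have hxC : ‖x - ∑ i, (z i : ℝ) • cc i‖ ≤ s * β := by
    have h := norm_xVecOf_sub_le hB hS hli hq c κ hsol.2.1 hσ
    refine (h.trans ?_).trans hxq.le
    have hσ0 : 0 ≤ σ := (norm_nonneg _).trans (hσ ⟨0, hn⟩)
    have hzn : ‖intVecToEuclidean m z‖ ≤ β := hsol.2.2
    gcongr
  have hintg : Integrable (fun y : Fin m → dualLat B => ⟪u, x - ∑ i, (z i : ℝ) • ((y i : dualLat B) : EuclideanSpace ℝ (Fin n))⟫_ℝ ^ 2)
      (condLawD B N s (fun _ => 0) c).toMeasure := by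
    rw [condLawD_zero]
    exact integrable_inner_output_sq (dualLat B) hs cc x u z
  have hI := integral_indepLaw_inner_witness_sq_le_sq (dualLat B) hε hε1 hs hηs cc hxC hz2 hnum hu
  have hout : ∀ y, outputD B N S q (((c, κ), (queryMatrixD B N S q c κ, z)), y) =
      x - ∑ i, (z i : ℝ) • ((y i : dualLat B) : EuclideanSpace ℝ (Fin n)) := fun y => rfl
  simp only [hout]
  rw [← lintegral_toMeasure_eq_tsum, ← ofReal_integral_eq_lintegral_ofReal hintg (ae_of_all _ fun y => sq_nonneg _)]
  refine ENNReal.ofReal_le_ofReal (le_of_eq_of_le ?_ hI)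
  rw [condLawD_zero]
  refine integral_congr_ae (Filter.Eventually.of_forall fun y => ?_)
  simp only [sub_sum_smul_eq x cc (fun i => ((y i : dualLat B) : EuclideanSpace ℝ (Fin n))) z, hcc]

/-- **Second moment of `‖w‖` under the conditional witness law**: `∑_w D(w) ‖w‖² ≤ n(2sβ)²`.
[cite: MicciancioRegev2007, Thm. 5.23 (proof, p. 31, eq. (18))] -/
theorem tsum_condD_mul_enorm_sq_le {ε s β σ : ℝ} (hε : 0 < ε) (hε1 : ε < 1) (hs : 0 < s)
    (hηs : 2 * smoothingParameter (dualLat B) ε ≤ s) (hn : 1 ≤ n) (hm : 0 < m) (hσ : ∀ j, ‖intVecToEuclidean n (S j)‖ ≤ σ)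
    (hxq : n * Real.sqrt m * β * σ / q < s * β)
    (hnum : 1 / (2 * π) + ε / (1 - ε) + (ε / (1 - ε)) ^ 2 * m ≤ 1) (ℓ : ℕ)
    (hρ : (wRunD B N S hB O s β ℓ) none ≠ 1) {D : PMF (WLat B)}
    (hD : ∀ w, (wRunD B N S hB O s β ℓ) (some w) = (1 - (wRunD B N S hB O s β ℓ) none) * D w) :
    ∑' w, D w * (‖((w : WLat B) : EuclideanSpace ℝ (Fin n))‖ₑ : ℝ≥0∞) ^ 2 ≤ n * ENNReal.ofReal ((2 * s * β) ^ 2) := by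
  set ob := stdOrthonormalBasis ℝ (EuclideanSpace ℝ (Fin n)) with hob
  have hfin : finrank ℝ (EuclideanSpace ℝ (Fin n)) = n := finrank_euclideanSpace_fin
  have hsq : ∀ w : EuclideanSpace ℝ (Fin n), (‖w‖ₑ : ℝ≥0∞) ^ 2 = ∑ k, ENNReal.ofReal (⟪ob k, w⟫_ℝ ^ 2) := fun w => by
    rw [← ofReal_norm, ← ENNReal.ofReal_pow (norm_nonneg _), ← ob.sum_sq_inner_right w,
      ENNReal.ofReal_sum_of_nonneg fun k _ => sq_nonneg _]
  simp_rw [hsq, Finset.mul_sum]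
  rw [Summable.tsum_finsetSum (fun _ _ => ENNReal.summable)]
  calc ∑ k, ∑' w, D w * ENNReal.ofReal (⟪ob k, ((w : WLat B) : EuclideanSpace ℝ (Fin n))⟫_ℝ ^ 2)
      ≤ ∑ _k : Fin (finrank ℝ (EuclideanSpace ℝ (Fin n))), ENNReal.ofReal ((2 * s * β) ^ 2) :=
        Finset.sum_le_sum fun k _ =>
          tsum_condD_mul_ofReal_inner_sq_le B N S hB hS hli O hε hε1 hs hηs hn hm hσ hxq hnum ℓ hρ hD (ob.orthonormal.1 k)
    _ = n * ENNReal.ofReal ((2 * s * β) ^ 2) := by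
        rw [Finset.sum_const, Finset.card_univ, Fintype.card_fin, nsmul_eq_mul, hfin]

end Cond

/-! ### The witnesses: `N_w` blocks of `k` runs -/

/-- **Blocks of runs read through their first success** (generic in the run law `p`): `N_w` independent
blocks of `k` independent runs each. [cite: MicciancioRegev2007, Thm. 5.23 (proof, step (3), p. 29: "let w₁, …, w_N be the first N successful outputs")] -/
def witnessesOf {α : Type*} (p : PMF (Option α)) (Nw k : ℕ) : PMF (Fin Nw → Option α) :=
  indepLaw Nw fun _ => (indepLaw k fun _ => p).map fun v => (List.ofFn v).findSome? id

omit [NeZero N] in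
/-- **Stability of the blocks in the run law**: `Δ(witnessesOf p, witnessesOf p′) ≤ N_w·k·Δ(p, p′)` (hybrid bound
over the `N_w k` runs, data processing for the first-success reading). [cite: Goldreich2001, §3.2 (Thm. 3.2.6, hybrid argument)] -/
theorem tvDist_witnessesOf_le {α : Type*} (p p' : PMF (Option α)) (Nw k : ℕ) :
    (witnessesOf p Nw k).tvDist (witnessesOf p' Nw k) ≤ Nw * (k * p.tvDist p') := by
  rw [witnessesOf, witnessesOf]
  refine (tvDist_indepLaw_le Nw _ _).trans ?_
  have hblock : ((indepLaw k fun _ => p).map fun v => (List.ofFn v).findSome? id).tvDist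
      ((indepLaw k fun _ => p').map fun v => (List.ofFn v).findSome? id) ≤ k * p.tvDist p' := by
    refine (tvDist_map_le_holds _ _ _).trans ((tvDist_indepLaw_le k _ _).trans (le_of_eq ?_))
    rw [Finset.sum_const, Finset.card_univ, Fintype.card_fin, nsmul_eq_mul]
  calc ∑ _i : Fin Nw, ((indepLaw k fun _ => p).map fun v => (List.ofFn v).findSome? id).tvDist
        ((indepLaw k fun _ => p').map fun v => (List.ofFn v).findSome? id)
      ≤ ∑ _i : Fin Nw, (k : ℝ) * p.tvDist p' := Finset.sum_le_sum fun i _ => hblock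
    _ = Nw * (k * p.tvDist p') := by rw [Finset.sum_const, Finset.card_univ, Fintype.card_fin, nsmul_eq_mul]

/-- **The witnesses** in the dual-grid model: `N_w` blocks of `k` runs of `W(B, S)`, each block read
through its first success. [cite: MicciancioRegev2007, Thm. 5.23 (proof, step (3), p. 29)] -/
def witnessesD (hB : B.det ≠ 0) {q : ℕ} (O : Matrix (Fin n) (Fin m) (ZMod q) → PMF (Fin m → ℤ)) (s β : ℝ) (ℓ Nw k : ℕ) :
    PMF (Fin Nw → Option (WLat B)) :=
  witnessesOf (wRunD B N S hB O s β ℓ) Nw k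

/-- **The witnesses of a NO instance are rejected by the modified verifier only with small probability**
(dual-grid model). Data: `L₀ = Λ*` (`Λ = dualLat B`), `n ≥ 2`, `0 < g < λ₁(L₀)`, `dist(kt′, L₀) > g` for odd
`k` (the scaled NO promise), ANY Gaussian parameter `s ≥ 2√n/g` with `2η_ε(Λ) ≤ s` (`ε = 2⁻ⁿ`; in MR07
`g = γd`, eq. (15)), `‖sⱼ‖ ≤ σ` with `n√m βσ/q < sβ` (Lemma 5.8 (iii) and the modulus condition), the side
condition of Thm. 5.9, an oracle whose `SIS′` success `δ′` on uniform queries exceeds the slack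
`m(2ε/(1+ε) + n·dT/2^ℓ + n·q/N)`, and thresholds `θ_b ≤ (1 − 2ε)/(2π²) − δ_H`, `Θ ≥ 3N_w(2sβ)²`:
`Pr[¬acceptsZ] ≤ N_w(1 − (δ′ − slack))^k + e^{−32N_wδ_H²} + e^{−N_w/(nm)²}(4√n·nm)ⁿ + N_w·m(1+ε)/(1−ε)ε`.
[cite: MicciancioRegev2007, Thm. 5.23 (proof, NO case, pp. 29–31) — distance-to-ℤ test] -/
theorem toReal_witnessesD_not_acceptsZ_le [IsZLattice ℝ (dualLat B)] (hB : B.det ≠ 0)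
    (hS : ∀ j, intVecToEuclidean n (S j) ∈ dualLat B) (hli : LinearIndependent ℝ fun j => intVecToEuclidean n (S j))
    [NeZero (MM B N S)] [NeZero (Mo B N)] {q : ℕ} [NeZero q] (hqN : q ≤ N)
    (O : Matrix (Fin n) (Fin m) (ZMod q) → PMF (Fin m → ℤ)) (hn2 : 2 ≤ n) (hm : 0 < m)
    (t' : EuclideanSpace ℝ (Fin n)) {g s β σ δH θb Θ : ℝ} (hβ : 0 < β) (hg : 0 < g)
    (hgL : g < minNorm (dualLattice (dualLat B)))
    (hodd : ∀ k : ℤ, Odd k → g < infDist ((k : ℝ) • t') ((dualLattice (dualLat B) : Set (EuclideanSpace ℝ (Fin n)))))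
    (hsle : 2 * Real.sqrt n / g ≤ s) (hηs2 : 2 * smoothingParameter (dualLat B) ((2⁻¹ : ℝ) ^ n) ≤ s)
    (hσ : ∀ j, ‖intVecToEuclidean n (S j)‖ ≤ σ) (hxq : n * Real.sqrt m * β * σ / q < s * β)
    (hnum : 1 / (2 * π) + (2⁻¹ : ℝ) ^ n / (1 - (2⁻¹ : ℝ) ^ n) + ((2⁻¹ : ℝ) ^ n / (1 - (2⁻¹ : ℝ) ^ n)) ^ 2 * m ≤ 1)
    (ℓ : ℕ)
    (hδ : m * (2 * (2⁻¹ : ℝ) ^ n / (1 + (2⁻¹ : ℝ) ^ n) + n * (((dT B S).toNat : ℝ) / 2 ^ ℓ) + n * ((q : ℝ) / N)) <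
      (((PMF.uniformOfFintype (Matrix (Fin n) (Fin m) (ZMod q))).bind fun A =>
          (O A).map (Prod.mk A)).toOuterMeasure {az | IsSolution' az.1 β az.2}).toReal)
    (Nw k : ℕ) [NeZero Nw] (hδH : 0 ≤ δH)
    (hθb : θb ≤ (1 - 2 * (2⁻¹ : ℝ) ^ n) / (2 * π ^ 2) - δH) (hΘ : Nw * (3 * (2 * s * β) ^ 2) ≤ Θ) :
    ((witnessesD B N S hB O s β ℓ Nw k).toOuterMeasure {o | ¬ acceptsZ (dualLattice (dualLat B)) t' θb Θ o}).toReal ≤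
      Nw * (1 - ((((PMF.uniformOfFintype (Matrix (Fin n) (Fin m) (ZMod q))).bind fun A =>
          (O A).map (Prod.mk A)).toOuterMeasure {az | IsSolution' az.1 β az.2}).toReal -
            m * (2 * (2⁻¹ : ℝ) ^ n / (1 + (2⁻¹ : ℝ) ^ n) + n * (((dT B S).toNat : ℝ) / 2 ^ ℓ) + n * ((q : ℝ) / N)))) ^ k +
        (Real.exp (-(32 * Nw * δH ^ 2)) +
          (Real.exp (-(Nw / Real.sqrt (n * m) ^ 4)) * (4 * Real.sqrt n * Real.sqrt (n * m) ^ 2) ^ n +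
            Nw * (m * ((1 + (2⁻¹ : ℝ) ^ n) / (1 - (2⁻¹ : ℝ) ^ n) * (2⁻¹ : ℝ) ^ n)))) := by
  have hfin : finrank ℝ (EuclideanSpace ℝ (Fin n)) = n := finrank_euclideanSpace_fin
  set ε : ℝ := (2⁻¹ : ℝ) ^ n with hεdef
  set p : PMF (Option (WLat B)) := wRunD B N S hB O s β ℓ with hpdef
  -- positivity
  have hn1 : 1 ≤ n := by omega
  have hε0 : 0 < ε := by rw [hεdef]; positivity
  have hε1 : ε < 1 := by
    rw [hεdef]
    calc (2⁻¹ : ℝ) ^ n ≤ (2⁻¹ : ℝ) ^ 1 := pow_le_pow_of_le_one (by norm_num) (by norm_num) hn1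
      _ < 1 := by norm_num
  have hsq : 0 < Real.sqrt n := Real.sqrt_pos.2 (by exact_mod_cast hn1)
  have hs₀ : 0 < 2 * Real.sqrt n / g := by positivity
  have hs : 0 < s := lt_of_lt_of_le hs₀ hsle
  have hm1 : (1 : ℝ) ≤ m := by exact_mod_cast hm
  have hnm : 1 ≤ n * m := Nat.one_le_iff_ne_zero.2 (Nat.mul_ne_zero (by omega) (by omega))
  have hK : 0 < Real.sqrt (n * m) := Real.sqrt_pos.2 (by exact_mod_cast hnm)
  have hℓ : 0 < 2 * s * β := by positivity
  have hη0 : 0 ≤ smoothingParameter (dualLat B) ε := smoothingParameter_nonneg (dualLat B) ε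
  have hηs : smoothingParameter (dualLat B) ε ≤ s := by linarith
  -- the auxiliary width `g' = 2√n/s ≤ g` of eq. (16)
  set g' : ℝ := 2 * Real.sqrt n / s with hg'def
  have hg' : 0 < g' := by rw [hg'def]; positivity
  have hg'le : g' ≤ g := by
    rw [hg'def, div_le_iff₀ hs]
    have h := (div_le_iff₀ hg).1 hsle
    linarith
  have hsg' : 2 * Real.sqrt n / g' = s := by rw [hg'def]; field_simp
  have hg'L : g' < minNorm (dualLattice (dualLat B)) := lt_of_le_of_lt hg'le hgL
  have hodd' : ∀ k : ℤ, Odd k → g' < infDist ((k : ℝ) • t') ((dualLattice (dualLat B) : Set (EuclideanSpace ℝ (Fin n)))) :=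
    fun k hk => lt_of_le_of_lt hg'le (hodd k hk)
  -- abort probability and the conditional witness law
  have hρle := toReal_wRunD_none_le B N S hB hS hli hqN O hε0 hs hηs β ℓ
  have hρlt : (p none).toReal < 1 := by rw [hpdef]; linarith
  have hρ : p none ≠ 1 := fun h => by rw [h, ENNReal.toReal_one] at hρlt; exact lt_irrefl _ hρlt
  obtain ⟨D, hD⟩ := exists_cond_law p hρ
  -- eqs. (16)–(18) for `D`
  have hpg' : wRunD B N S hB O (2 * Real.sqrt n / g') β ℓ = p := by rw [hsg']
  have hρ' : (wRunD B N S hB O (2 * Real.sqrt n / g') β ℓ) none ≠ 1 := by rw [hpg']; exact hρ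
  have hD' : ∀ w, (wRunD B N S hB O (2 * Real.sqrt n / g') β ℓ) (some w) =
      (1 - (wRunD B N S hB O (2 * Real.sqrt n / g') β ℓ) none) * D w := fun w => by rw [hpg']; exact hD w
  have h16 := tsum_condD_toReal_mul_cos_le B N S hB hS O hn2 hg' hg'L t' hodd' β ℓ hρ' hD'
  have h17 := tsum_condD_toReal_mul_indicator_le B N S hB hS hli O hε0 hε1 hs hηs hn1 hm hσ hxq ℓ hρ hD
  have hnum' : 1 / (2 * π) + ε / (1 - ε) + (ε / (1 - ε)) ^ 2 * m ≤ 1 := by rw [hεdef]; exact hnum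
  have h18 : ∀ u : EuclideanSpace ℝ (Fin n), ‖u‖ = 1 →
      ∑' w, D w * ENNReal.ofReal (⟪u, ((w : WLat B) : EuclideanSpace ℝ (Fin n))⟫_ℝ ^ 2) ≤ ENNReal.ofReal ((2 * s * β) ^ 2) :=
    fun u hu => tsum_condD_mul_ofReal_inner_sq_le B N S hB hS hli O hε0 hε1 hs hηs2 hn1 hm hσ hxq hnum' ℓ hρ hD hu
  have hnorm := tsum_condD_mul_enorm_sq_le B N S hB hS hli O hε0 hε1 hs hηs2 hn1 hm hσ hxq hnum' ℓ hρ hD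
  -- the blocks, through the verifier analysis with `L = L₀ = Λ*`
  have h16f : ∑' w, (D w).toReal * Real.cos (2 * π * ⟪t', ((w : WLat B) : EuclideanSpace ℝ (Fin n))⟫_ℝ) ≤
      2 * (2⁻¹ : ℝ) ^ finrank ℝ (EuclideanSpace ℝ (Fin n)) := by rw [hfin]; exact h16
  have h17f : ∑' w, (D w).toReal * (if Real.sqrt (n * m) * (2 * s * β) ≤ ‖((w : WLat B) : EuclideanSpace ℝ (Fin n))‖ then (1 : ℝ)
      else 0) ≤ m * ((1 + ε) / (1 - ε) * ε) := h17
  have hθb' : θb ≤ (1 - 2 * (2⁻¹ : ℝ) ^ finrank ℝ (EuclideanSpace ℝ (Fin n))) / (2 * π ^ 2) - δH := by rw [hfin]; exact hθb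
  have hmain := toReal_blocks_not_acceptsZ_le (dualLattice (dualLat B)) t' hℓ hK p hD h16f h18 h17f
    (ENNReal.mul_ne_top (ENNReal.natCast_ne_top _) ENNReal.ofReal_ne_top) hnorm Nw k hδH hθb' hΘ
  rw [hfin] at hmain
  rw [witnessesD, witnessesOf, ← hpdef]
  refine hmain.trans ?_
  gcongr
  rw [ENNReal.toReal_pow]
  exact pow_le_pow_left₀ ENNReal.toReal_nonneg hρle k

end DualGrid

end Literature.Algebra.EuclideanLattices

end
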